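import Summits.QuantumFields.QCD.Theorems.PauliWegnerSeaChiralGluonicCompletionGoldstoneOfHereditaryPin
import Summits.QuantumFields.QCD.Theorems.PauliWegnerSeaChiralGluonicCompletionStubSecondMomentOfFmChiralTwo
import Summits.QuantumFields.QCD.Theorems.PauliWegnerSeaChiralGluonicCompletionStubGoldstoneOfSecondMomentTwo
import Summits.QuantumFields.QCD.Theorems.PauliWegnerSeaChiralGluonicCompletionStubFmChiralOfVanishingRateTwo
import Summits.QuantumFields.QCD.Theorems.PauliWegnerSeaChiralGluonicCompletionStubGoldstoneOfSignInputsThree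

/-!
# Crux `ChiralGluonicCompletion` (stmt-QuantumFields-17498) — line `Sketch` (card strongly-chiral-subsequence):
# the registered skeleton, RESHAPED at cycle 3 (rev 5; lead prover-line-stmt-QuantumFields-17498-c2-0, 2026-08-17)

`Summit.QuantumFields.QCD.Theses.PauliWegnerSea.ChiralGluonicCompletion` (= `WilsonMobilityGap.ChiralGluonicCompletion`,
`rfl`): for `N_f ∈ {2,3}`, a regularisation `reg` with `HasMassScaling`, `IsChiralAtZero`, asymptotic scaling and, for
every `m > 0`, clauses (i)–(iv) + the flavour-charged phase-quenched decay (PQFD) ⟹ `QCDOf N_f`.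

## Shape of the line (unchanged)
Every line of this crux must subsequence (the pin `IsChiralAtZero` is `∃ᶠ k`, not hereditary; keep-reg is dead by
`m_crit`-interleaving and by blow-up points, `Cruxes/ChiralGluonicCompletion/Disproof.lean` §3/§5), so the completion is
routed through a subsequence along which chirality SURVIVES the uncontrolled extractions of the continuum step.  The
composition over (E, C1, C2) is landed: `chiralGluonicCompletion_of_stubs` (…Restrict.lean, p134547; E consumed as
`∃ φ, (reg.restrict φ).HasGoldstoneBound`) and, since this cycle, `chiralGluonicCompletion_of_hereditaryPin`
(…GoldstoneOfHereditaryPin.lean, p137857; E consumed as the weaker E* below).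

## Rev 5 — the chirality engine E weakened to its order-theoretic core E* (this cycle's reshape)
`stub_hereditaryPin` (E*): along SOME subsequence `reg.restrict φ` the pin holds HEREDITARILY, i.e. along every further
subsequence.  Why this is the right stub:
* it is EXACTLY what the composition needs, modulo C1: `exists_restrict_hasGoldstoneBound_of_hereditaryPin` (p137857)
  proves E* ∧ C1 ⇒ `∃ θ, (reg.restrict θ).HasGoldstoneBound` — single-scale Goldstone selection (the pin at rate `ε/2`
  gives violations at every level frequently in `k`; the C1 gap bound at the same tuple forces the violating separations
  to have `a_k n_k → ∞`; select), nested over the rates `1/(i+1)`, then the diagonal — and conversely a Goldstone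
  subsequence is hereditarily pinned (`hereditaryPin_of_hasGoldstoneBound`);
* it is WEAKER than both cycle-2 cores and flavour-uniform: `hereditaryPin_of_vanishingRate_two` /
  `hereditaryPin_of_core_three` below (through the landed chain p136372 → p135565 → p135713 and p136403); in particular
  the `N_f = 3` SIGN input of rev 4 (`PionWeightSignCoherent`) is gone — it was an artefact of reaching the Goldstone
  bound through phase-quenched clause-(iii) lower bounds, whereas E* reads the pin's own (signed, honest) violations;
* it is FREE (`φ = id`, `hereditaryPin_of_eventual`, p137857) under the `∀ᶠ`-upgrade of the typed `∃ᶠ` pin, which every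
  honest chiral construction (17497's line included) delivers: the residual content of E* over `Hyp` is pure
  SCALE-COHERENCE of the pin (one infinite set of cutoffs along which the gap closes at ALL scales), not derivable from
  the `∃ᶠ` pin by logic (fragmented witnesses, FINDINGS G1–G3) and not supplied by (ii)/(iii)/(iv)/PQFD (no control of
  clause-(iii) rates as `m → 0`).  OPEN; the minimal re-type of the crux hypothesis that closes it is recorded in
  `hereditaryPin_of_eventual`'s hypothesis.
* `stub_latticeGap` (C1, OPEN; blocked on `DiagonalSpine.FullLatticeGap` 8928, calibration p134665) is unchanged; its
  provable slice (N_f = 2, degenerate masses, flavour-CHARGED observables: honest = phase-quenched, flavour selection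
  rule, PQFD) is the registered sub-goal `stub_chargedGap_two_degenerate` of this cycle.
* `stub_continuum` (C2) is RE-REGISTERED in the weaker GLOBAL, gap-conditioned form C2' (one subsequence for all positive
  tuples, given the lattice gap at every positive tuple — the ∀-regularisation frame of DiagonalSpine's continuum items
  8840/14675/14676; cycle-3 worker suggestion): the local rev-3/4 form implies it (`globalContinuum_of_local`,
  `continuumGlobal_of_continuumLocal`, landed with the rev-5 composition `chiralGluonicCompletion_of_hereditaryPin_globalContinuum`
  in …GlobalContinuum.lean); still OPEN (blocked on `DiagonalSpine.LatticeToContinuum` 8929-type content for a GIVEN reg: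
  OS closure + non-triviality + continuum gap; worker verdict cycle 3: no tree fact supplies it).
* Along subsequences HEREDITARY PIN ⟺ EVENTUAL PIN ⟺ SCALE-COHERENCE of the violations (finite-intersection property
  across rates): `hereditaryPin_iff_eventualPin_along_subsequences`, `hereditaryPin_iff_scaleCoherent`
  (…StubHereditaryPin.lean, p139008, cycle-3 E* worker): the residual content of E* over `Hyp` is exactly the `∃ᶠ ↦ ∀ᶠ`
  upgrade of the typed pin along one infinite set of cutoffs (the typed pin is the single-rate case of scale-coherence);
  worker verdict: not derivable from `Hyp` (violations of rate 1/i prescribed on pairwise disjoint blocks of cutoffs defeat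
  it while satisfying the pin's shape).  §4 below records the consequence for the planners (`qcdOf_of_eventualPin`).
* Cycle 5 (lead c4, 2026-08-17; stub set UNCHANGED, rev 5 re-registered): §6 makes that verdict kernel-checked at the level of
  pure logic — `pinShape_not_entails_hereditaryPin` (an antitone violation predicate with the pin's `∀ ε ∃ m ∃ᶠ k` shape that is
  hereditarily pinned along NO subsequence, even re-choosing the tuple per rate and per subsequence; landed as
  `Theorems/PauliWegnerSeaChiralGluonicCompletionPinShapeModel.lean`, p142184) versus `eventualShape_hereditary`.  Reading: E*
  needs an input absent from the SHAPE of `Hyp` (mass-continuity of the lattice correlators uniformly in the cutoff /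
  `ChiralTuning`-type content for the GIVEN reg, or the eventual pin itself) — a planner action (re-type or split), not a stub.
-/

noncomputable section

namespace Summit.QuantumFields.QCD.Theorems.StronglyChiralSubsequence

open MeasureTheory Filter Topology
open Literature.MathematicalPhysics.QuantumFieldTheory Literature.MathematicalPhysics.QuantumLattice
  Literature.Probability.LatticeModels
open Summit.QuantumFields.QCD.Theorems.MobilityGapNegative (bare fm Sign)
open Summit.QuantumFields.QCD.Theorems.ChiralMobilityGapSketch (VanishingChiralRate SuperLogVolume PionWeightSignCoherent)

/-! ## §1 The stubs -/

/-- **Stub E* — the hereditary pin along a subsequence (the chirality core, rev 5).**  From the crux's package on `reg`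
(pin `IsChiralAtZero`, clauses (i)–(iv), PQFD, scalings), SOME subsequence `reg.restrict φ` is chiral at zero along EVERY
further subsequence: for every `ψ`, `((reg.restrict φ).restrict ψ).IsChiralAtZero`.  Equivalent over C1 to the Goldstone
form the composition consumes (`exists_restrict_hasGoldstoneBound_of_hereditaryPin` / `hereditaryPin_of_hasGoldstoneBound`,
p137857); implied by each cycle-2 core (§3 below); free under an EVENTUAL pin (`hereditaryPin_of_eventual`).  Residual
content over `Hyp`: scale-coherence of the `∃ᶠ` pin.  OPEN. -/
theorem stub_hereditaryPin : ∀ Nf : ℕ, Nf = 2 ∨ Nf = 3 → ∀ reg : QCDRegularisation Nf, Hyp Nf reg →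
    ∃ φ : ℕ → ℕ, ∃ hφ : StrictMono φ, ∀ (ψ : ℕ → ℕ) (hψ : StrictMono ψ),
      ((reg.restrict φ hφ.tendsto_atTop).restrict ψ hψ.tendsto_atTop).IsChiralAtZero := by
  sorry

/-- **Stub C1 — the signed lattice half at the given critical line.**  From the package on `reg`, for EVERY positive
mass tuple `m` the honest (signed-determinant) lattice theory `reg.scheme m 0 0` has a uniform lattice mass gap
`Δ(m) > 0`: ALL pairs of gauge-invariant local lattice observables, ALL tori `S ≥ L_k`, eventually in `k`
(`QCDScheme.HasLatticeMassGap`).  Content: the sign problem beyond the scheme's own side (clause (iv) lives at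
`S = L_k` only), the flavour-NEUTRAL and gluonic channels (uniform clustering of lattice Yang–Mills at weak coupling),
the charged channels from (ii)/PQFD.  OPEN; worker verdict cycle 1: `stub-blocked: DiagonalSpine.FullLatticeGap`
(stmt-QuantumFields-8928; calibration `fullLatticeGap_of_stub`, p134665).  Caveat (Disproof §5): as a `∀ reg` item it
would already fail on a `Hyp`-witness that is chiral BY BLOW-UP (`no_sameReg_latticeGap_of_blowsUpAt`) — none is known. -/
theorem stub_latticeGap : ∀ Nf : ℕ, Nf = 2 ∨ Nf = 3 → ∀ reg : QCDRegularisation Nf, Hyp Nf reg →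
    ∀ m : Fin Nf → ℝ, (∀ f, 0 < m f) → ∃ Δ > 0, (reg.scheme m 0 0).HasLatticeMassGap Δ := by
  sorry

/-- **Stub C2' — the continuum half, GLOBAL gap-conditioned form (rev 5).**  From the package on `reg` AND a uniform
lattice gap at every positive tuple (C1's output for the same `reg`), ONE subsequence `reg.restrict φ` along which, for
every positive tuple `m`, species renormalisations `z, shift` and OS data `T` exist with `IsQCDAlong`, non-trivial
non-Gaussian glue, every flavour-changing pseudoscalar non-trivial, and a continuum gap `T.HasMassGap Δ(m) > 0`
(`ContinuumBody`).  Weaker than the local rev-3/4 form (`continuumGlobal_of_continuumLocal`).  OPEN; worker verdicts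
cycle 1 / cycle 3: blocked on `DiagonalSpine.LatticeToContinuum` (stmt-QuantumFields-8929)-type content for a GIVEN
regularisation (OS closure E0′,E2–E4, non-triviality ×3, continuum gap — no tree fact supplies any of it). -/
theorem stub_continuum : ∀ Nf : ℕ, Nf = 2 ∨ Nf = 3 → ∀ reg : QCDRegularisation Nf, Hyp Nf reg →
    (∀ m : Fin Nf → ℝ, (∀ f, 0 < m f) → ∃ Δ > 0, (reg.scheme m 0 0).HasLatticeMassGap Δ) →
      ∃ φ : ℕ → ℕ, ∃ hφ : StrictMono φ, ∀ m : Fin Nf → ℝ, (∀ f, 0 < m f) →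
        ContinuumBody Nf (reg.restrict φ hφ.tendsto_atTop) m := by
  sorry

/-! ## §2 Composition -/

/-- **The chirality engine E from E* and C1** (landed glue `exists_restrict_hasGoldstoneBound_of_hereditaryPin`). -/
theorem goldstone_of_stubs : ∀ Nf : ℕ, Nf = 2 ∨ Nf = 3 → ∀ reg : QCDRegularisation Nf, Hyp Nf reg →
    ∃ φ : ℕ → ℕ, ∃ hφ : StrictMono φ, (reg.restrict φ hφ.tendsto_atTop).HasGoldstoneBound := by
  intro Nf hNf reg hH
  obtain ⟨φ, hφ, hher⟩ := stub_hereditaryPin Nf hNf reg hH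
  exact exists_restrict_hasGoldstoneBound_of_hereditaryPin reg φ hφ hher (stub_latticeGap Nf hNf reg hH)

/-- **The crux along line `Sketch`, modulo its stubs** (route PauliWegnerSea's copy, by name).  The body is verbatim the
landed rev-5 composition `chiralGluonicCompletion_of_hereditaryPin_globalContinuum` (…GlobalContinuum.lean, p139623; inlined
here so that the skeleton elaborates before that module is built on the farm): E* ∧ C1 give a Goldstone subsequence
(`exists_restrict_hasGoldstoneBound_of_hereditaryPin`), the package passes to it (`hyp_restrict`), C2' — fed with C1's gap
there — gives one further subsequence for all masses, along which the Goldstone bound (hence the package and the pin)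
survives, C1 supplies the lattice gap and `body_of_parts` the matrix of `QCDOf`. -/
theorem ChiralGluonicCompletion_of : Summit.QuantumFields.QCD.Theses.PauliWegnerSea.ChiralGluonicCompletion := by
  intro Nf hNf hex
  obtain ⟨reg, hH⟩ := hex
  obtain ⟨φ, hφ, hher⟩ := stub_hereditaryPin Nf hNf reg hH
  obtain ⟨θ, hθ, hG⟩ := exists_restrict_hasGoldstoneBound_of_hereditaryPin reg φ hφ hher (stub_latticeGap Nf hNf reg hH)
  have hH₀ : Hyp Nf (reg.restrict θ hθ.tendsto_atTop) := hyp_restrict reg θ hθ hH hG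
  obtain ⟨φ₁, hφ₁, hcont⟩ := stub_continuum Nf hNf _ hH₀ (stub_latticeGap Nf hNf _ hH₀)
  have hG₁ : ((reg.restrict θ hθ.tendsto_atTop).restrict φ₁ hφ₁.tendsto_atTop).HasGoldstoneBound :=
    hG.restrict φ₁ hφ₁.tendsto_atTop
  have hH₁ : Hyp Nf ((reg.restrict θ hθ.tendsto_atTop).restrict φ₁ hφ₁.tendsto_atTop) := hyp_restrict _ φ₁ hφ₁ hH₀ hG₁
  unfold QCDOf
  exact ⟨(reg.restrict θ hθ.tendsto_atTop).restrict φ₁ hφ₁.tendsto_atTop, hH₁.1, hG₁.isChiralAtZero,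
    fun m hm => body_of_parts _ m (hcont m hm) (stub_latticeGap Nf hNf _ hH₁ m hm)⟩

/-- The same for route WilsonMobilityGap's copy of the crux (the same proposition). -/
theorem WilsonMobilityGap_ChiralGluonicCompletion_of :
    Summit.QuantumFields.QCD.Theses.WilsonMobilityGap.ChiralGluonicCompletion :=
  ChiralGluonicCompletion_of

/-! ## §3 Monotonicity of the reshape: each cycle-2 core implies E* (sorry-free) -/

/-- Rev 4's `N_f = 2` core implies E*: the vanishing chiral rate along `φ` gives the Goldstone bound of `reg.restrict φ`
(landed chain p136372 → p135565 → p135713), hence the hereditary pin along `φ`. -/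
theorem hereditaryPin_of_vanishingRate_two (reg : QCDRegularisation 2) (φ : ℕ → ℕ) (hφ : StrictMono φ)
    (hV : VanishingChiralRate (reg.restrict φ hφ.tendsto_atTop)) :
    ∀ (ψ : ℕ → ℕ) (hψ : StrictMono ψ), ((reg.restrict φ hφ.tendsto_atTop).restrict ψ hψ.tendsto_atTop).IsChiralAtZero :=
  hereditaryPin_of_hasGoldstoneBound reg φ hφ (stub_goldstone_of_secondMoment_two _
    (stub_secondMoment_of_fmChiral_two _ (stub_fmChiral_of_vanishingRate_two _ hV)))

/-- Rev 4's `N_f = 3` core implies E*: the three add-ons along `φ` and clause (iv) of `Hyp` along `φ` give the Goldstone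
bound of `reg.restrict φ` (p136403), hence the hereditary pin along `φ`. -/
theorem hereditaryPin_of_core_three (reg : QCDRegularisation 3) (hH : Hyp 3 reg) (φ : ℕ → ℕ) (hφ : StrictMono φ)
    (hV : VanishingChiralRate (reg.restrict φ hφ.tendsto_atTop)) (hL : SuperLogVolume (reg.restrict φ hφ.tendsto_atTop))
    (hσ : PionWeightSignCoherent (reg.restrict φ hφ.tendsto_atTop)) :
    ∀ (ψ : ℕ → ℕ) (hψ : StrictMono ψ), ((reg.restrict φ hφ.tendsto_atTop).restrict ψ hψ.tendsto_atTop).IsChiralAtZero := by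
  refine hereditaryPin_of_hasGoldstoneBound reg φ hφ (stub_goldstone_of_signInputs_three _ (fun t ht => ?_) hL hσ hV)
  have hIV : ClauseIV 3 reg (fun _ => t) := (hH.2.2.2 (fun _ => t) fun _ => ht).1.2.2.2
  exact hφ.tendsto_atTop.eventually hIV

/-! ## §4 Calibration of E* for the planners (sorry-free modulo C1/C2): under the EVENTUAL pin E* is free -/

/-- **Per-witness assembly** (the body of the rev-5 composition for ONE regularisation): a `Hyp`-witness with a
Goldstone subsequence completes to `QCDOf N_f`, modulo C1 and C2'. -/
theorem qcdOf_of_goldstone {Nf : ℕ} (hNf : Nf = 2 ∨ Nf = 3) (reg : QCDRegularisation Nf) (hH : Hyp Nf reg)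
    (hG : ∃ θ : ℕ → ℕ, ∃ hθ : StrictMono θ, (reg.restrict θ hθ.tendsto_atTop).HasGoldstoneBound) : QCDOf Nf := by
  obtain ⟨θ, hθ, hG⟩ := hG
  have hH₀ : Hyp Nf (reg.restrict θ hθ.tendsto_atTop) := hyp_restrict reg θ hθ hH hG
  obtain ⟨φ₁, hφ₁, hcont⟩ := stub_continuum Nf hNf _ hH₀ (stub_latticeGap Nf hNf _ hH₀)
  have hG₁ : ((reg.restrict θ hθ.tendsto_atTop).restrict φ₁ hφ₁.tendsto_atTop).HasGoldstoneBound :=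
    hG.restrict φ₁ hφ₁.tendsto_atTop
  have hH₁ : Hyp Nf ((reg.restrict θ hθ.tendsto_atTop).restrict φ₁ hφ₁.tendsto_atTop) := hyp_restrict _ φ₁ hφ₁ hH₀ hG₁
  unfold QCDOf
  exact ⟨(reg.restrict θ hθ.tendsto_atTop).restrict φ₁ hφ₁.tendsto_atTop, hH₁.1, hG₁.isChiralAtZero,
    fun m hm => body_of_parts _ m (hcont m hm) (stub_latticeGap Nf hNf _ hH₁ m hm)⟩

/-- **Under the EVENTUAL pin the chirality stub disappears.**  If a `Hyp`-witness has its pin in `∀ᶠ k` form (one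
channel per rate, violations at every level for all large `k` — what an honest chiral construction gives), then it
completes to `QCDOf N_f` modulo C1 and C2 ONLY: the eventual pin is hereditary (`hereditaryPin_of_eventual`), C1 upgrades
it to a Goldstone subsequence (`exists_restrict_hasGoldstoneBound`), and `qcdOf_of_goldstone` assembles.  This is the
Lean form of the line's re-type recommendation for the crux hypothesis. -/
theorem qcdOf_of_eventualPin {Nf : ℕ} (hNf : Nf = 2 ∨ Nf = 3) (reg : QCDRegularisation Nf) (hH : Hyp Nf reg)
    (hEv : ∀ ε > (0 : ℝ), ∃ m : Fin Nf → ℝ, (∀ f, 0 < m f) ∧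
      ∃ (R R' : ℕ) (A : QCDLatticeObservable Nf R) (B : QCDLatticeObservable Nf R'), ∀ C : ℝ, ∀ᶠ k in atTop,
        ∃ S : ℕ, reg.L k ≤ S ∧ ∃ n : ℕ, n ≤ S ∧ C * Real.exp (-(ε * (reg.a k * n))) <
          ‖qcdLatticeConnectedCorr (reg.β k) (2 * S + 1) (fun fl => (reg.scheme m 0 0).mq fl k) A B n‖) :
    QCDOf Nf :=
  qcdOf_of_goldstone hNf reg hH (exists_restrict_hasGoldstoneBound reg (hereditaryPin_of_eventual reg hEv)
    (stub_latticeGap Nf hNf reg hH))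

/-! ## §5 The recommended RE-TYPE of the crux, spelled out (a workfile `def`; closes modulo C1 and C2' only) -/

/-- **The eventual pin** of a regularisation (the `∀ᶠ`-upgrade of `QCDRegularisation.IsChiralAtZero`): for every rate
`ε > 0` some positive tuple and ONE channel violate the `ε`-gap bound at every level for ALL LARGE `k`. -/
def EventualPin (Nf : ℕ) (reg : QCDRegularisation Nf) : Prop :=
  ∀ ε > (0 : ℝ), ∃ m : Fin Nf → ℝ, (∀ f, 0 < m f) ∧
    ∃ (R R' : ℕ) (A : QCDLatticeObservable Nf R) (B : QCDLatticeObservable Nf R'), ∀ C : ℝ, ∀ᶠ k in atTop,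
      ∃ S : ℕ, reg.L k ≤ S ∧ ∃ n : ℕ, n ≤ S ∧ C * Real.exp (-(ε * (reg.a k * n))) <
        ‖qcdLatticeConnectedCorr (reg.β k) (2 * S + 1) (fun fl => (reg.scheme m 0 0).mq fl k) A B n‖

/-- The eventual pin implies the typed pin (`hereditaryPin_of_eventual` at the identity subsequence, which is `reg` itself
definitionally). -/
theorem isChiralAtZero_of_eventualPin {Nf : ℕ} (reg : QCDRegularisation Nf) (h : EventualPin Nf reg) :
    reg.IsChiralAtZero :=
  hereditaryPin_of_eventual reg h id strictMono_id

/-- **The re-typed hypothesis package**: `Hyp` with the pin replaced by its eventual form. -/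
def HypEv (Nf : ℕ) (reg : QCDRegularisation Nf) : Prop :=
  reg.HasMassScaling ∧ EventualPin Nf reg ∧ (reg.scheme 0 0 0).HasAsymptoticScaling ∧
    ∀ m : Fin Nf → ℝ, (∀ f, 0 < m f) → PerMass Nf reg m

/-- The re-typed package implies the typed one. -/
theorem hyp_of_hypEv {Nf : ℕ} (reg : QCDRegularisation Nf) (h : HypEv Nf reg) : Hyp Nf reg :=
  ⟨h.1, isChiralAtZero_of_eventualPin reg h.2.1, h.2.2.1, h.2.2.2⟩

/-- **The recommended re-type of `ChiralGluonicCompletion`** (planner-facing; identical to the crux except that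
`reg.IsChiralAtZero` is replaced by `EventualPin N_f reg` in the hypothesis). -/
def ChiralGluonicCompletionEventual : Prop :=
  ∀ Nf : ℕ, Nf = 2 ∨ Nf = 3 → (∃ reg : QCDRegularisation Nf, HypEv Nf reg) → QCDOf Nf

/-- **The re-typed crux closes modulo C1 and C2' ONLY** (no chirality stub): `qcdOf_of_eventualPin`. -/
theorem chiralGluonicCompletionEventual_of : ChiralGluonicCompletionEventual := by
  rintro Nf hNf ⟨reg, hH⟩
  exact qcdOf_of_eventualPin hNf reg (hyp_of_hypEv reg hH) hH.2.1

/-- And the re-typed crux is WEAKER than the typed one as an implication target: the typed crux implies it. -/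
theorem chiralGluonicCompletionEventual_of_crux
    (h : Summit.QuantumFields.QCD.Theses.PauliWegnerSea.ChiralGluonicCompletion) : ChiralGluonicCompletionEventual :=
  fun Nf hNf ⟨reg, hH⟩ => h Nf hNf ⟨reg, hyp_of_hypEv reg hH⟩

/-! ## §6 (cycle 5) The SHAPE of the pin does not entail E* — a kernel-checked countermodel

The cycle-3 verdict on `stub_hereditaryPin` ("not derivable from `Hyp`") made precise at the level of pure logic.  Abstract
the crux's hypothesis to what it says about gap violations: a predicate `V ε m k` ("at cutoff `k` the positive tuple `m` —
with its channel, the level `C` folded in — violates the `ε`-gap bound"), ANTITONE in the rate (a violation at rate `ε` is one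
at every `ε' ≥ ε`), subject only to the pin's shape `∀ ε > 0, ∃ m > 0, ∃ᶠ k, V ε m k`; the per-mass clauses (i)–(iv)/PQFD
constrain each tuple separately with `m`-dependent constants and impose nothing on `V` across tuples or cutoffs.  E* asks for
`∃ φ, ∀ ψ, ∀ ε > 0, ∃ m > 0, ∃ᶠ k, V ε m (φ (ψ k))` — NOTE the freedom to re-choose the tuple `m` per rate and per
subsequence, which is what makes E* more than "`∃ᶠ` is not subsequence-stable" (`Sketch_ideator1_r1.frequently_not_subseq_stable`).
`pinShape_not_entails_hereditaryPin` exhibits a `V` with the pin's shape that is hereditarily pinned along NO subsequence: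
cutoffs are grouped into infinitely many infinite blocks (`blockIdx k = (Nat.unpair k).1`), and at a cutoff of block `i` only
the tuple `1/(i+1)` is light, with "pion mass" `1/(i+1)`.  Every rate is violated infinitely often (inside one block), but a
subsequence either meets some block infinitely often — then along that sub-subsequence nothing is lighter than that block's
pion mass — or leaves every block eventually — then every fixed tuple is eventually heavy.  Consequently ANY proof of E* must
use an input absent from the shape of `Hyp`: analytic structure tying different masses and cutoffs together (continuity of
the lattice correlators in the bare mass uniformly in the cutoff, a compact "offset" parametrisation of the critical line —
`DiagonalSpine.MassEquicontinuity` / `ChiralTuning`-type content for the GIVEN regularisation), or the eventual form of the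
pin itself (`hereditaryPin_of_eventual`, landed).  Nothing here is a statement about lattice QCD; it bounds what selection
arguments can do. -/

section IndependenceModel

/-- The block of a cutoff: `blockIdx k = (Nat.unpair k).1`.  Every fibre `{k | blockIdx k = i}` is infinite. -/
def blockIdx (k : ℕ) : ℕ := (Nat.unpair k).1

/-- `Nat.pair i j` lies in block `i`. -/
theorem blockIdx_pair (i j : ℕ) : blockIdx (Nat.pair i j) = i := by
  simp [blockIdx, Nat.unpair_pair]

/-- Every block is met frequently (it contains `Nat.pair i j ≥ j` for every `j`). -/
theorem frequently_blockIdx_eq (i : ℕ) : ∃ᶠ k in atTop, blockIdx k = i :=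
  frequently_atTop.2 fun a => ⟨Nat.pair i a, Nat.right_le_pair i a, blockIdx_pair i a⟩

/-- **The model violation predicate**: at a cutoff of block `i` exactly the tuple `1/(i+1)` is light, with pion mass
`1/(i+1)` — `modelViolation ε m k` iff `m = 1/(i+1)`, `blockIdx k = i` and `1/(i+1) < ε` for some `i`. -/
def modelViolation (ε m : ℝ) (k : ℕ) : Prop :=
  ∃ i : ℕ, m = 1 / ((i : ℝ) + 1) ∧ blockIdx k = i ∧ 1 / ((i : ℝ) + 1) < ε

/-- The model is antitone in the rate, as gap violations are. -/
theorem modelViolation_mono {ε ε' m : ℝ} {k : ℕ} (h : modelViolation ε m k) (hle : ε ≤ ε') :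
    modelViolation ε' m k := by
  obtain ⟨i, hm, hk, hi⟩ := h
  exact ⟨i, hm, hk, hi.trans_le hle⟩

/-- **The model has the pin's shape**: every rate is violated, at a positive tuple, frequently in the cutoff. -/
theorem modelViolation_pinShape : ∀ ε > (0 : ℝ), ∃ m : ℝ, 0 < m ∧ ∃ᶠ k in atTop, modelViolation ε m k := by
  intro ε hε
  obtain ⟨i, hi⟩ := exists_nat_one_div_lt hε
  exact ⟨1 / ((i : ℝ) + 1), Nat.one_div_pos_of_nat, (frequently_blockIdx_eq i).mono fun k hk => ⟨i, rfl, hk, hi⟩⟩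

/-- **The model is hereditarily pinned along NO subsequence** (strong form): every subsequence `φ` has a further
subsequence `ψ` and a rate `ε > 0` at which EVERY tuple is eventually gapped. -/
theorem modelViolation_not_hereditary (φ : ℕ → ℕ) (_hφ : StrictMono φ) :
    ∃ ψ : ℕ → ℕ, StrictMono ψ ∧ ∃ ε > (0 : ℝ), ∀ m : ℝ, ∀ᶠ k in atTop, ¬ modelViolation ε m (φ (ψ k)) := by
  by_cases h : ∃ i₀ : ℕ, ∃ᶠ k in atTop, blockIdx (φ k) = i₀
  · -- some block is met infinitely often: extract it; nothing there is lighter than `1/(i₀+1)`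
    obtain ⟨i₀, hi₀⟩ := h
    obtain ⟨ψ, hψ, hψi⟩ := extraction_of_frequently_atTop hi₀
    refine ⟨ψ, hψ, 1 / ((i₀ : ℝ) + 1), Nat.one_div_pos_of_nat, fun m => Eventually.of_forall fun k => ?_⟩
    rintro ⟨i, -, hk, hi⟩
    rw [hψi k] at hk
    subst hk
    exact lt_irrefl _ hi
  · -- every block is left eventually: every fixed tuple is eventually heavy (rate `1`)
    simp only [not_exists, not_frequently] at h
    refine ⟨id, strictMono_id, 1, one_pos, fun m => ?_⟩
    by_cases hm : ∃ i : ℕ, m = 1 / ((i : ℝ) + 1)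
    · obtain ⟨i, rfl⟩ := hm
      refine (h i).mono fun k hk => ?_
      rintro ⟨j, hj, hk', -⟩
      rw [one_div, one_div, inv_inj] at hj
      have hij : i = j := by exact_mod_cast add_right_cancel hj
      exact hk (hk'.trans hij.symm)
    · exact Eventually.of_forall fun k ⟨i, hi, _, _⟩ => hm ⟨i, hi⟩

/-- **The pin's shape does not entail the hereditary pin (E*)** — even with the freedom to re-choose the tuple per rate
and per subsequence: an antitone violation predicate with the pin's shape, hereditarily pinned along no subsequence. -/
theorem pinShape_not_entails_hereditaryPin :
    ∃ V : ℝ → ℝ → ℕ → Prop,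
      (∀ ε ε' m k, V ε m k → ε ≤ ε' → V ε' m k) ∧
      (∀ ε > (0 : ℝ), ∃ m : ℝ, 0 < m ∧ ∃ᶠ k in atTop, V ε m k) ∧
      ¬ ∃ φ : ℕ → ℕ, StrictMono φ ∧ ∀ ψ : ℕ → ℕ, StrictMono ψ →
          ∀ ε > (0 : ℝ), ∃ m : ℝ, 0 < m ∧ ∃ᶠ k in atTop, V ε m (φ (ψ k)) := by
  refine ⟨modelViolation, fun ε ε' m k h hle => modelViolation_mono h hle, modelViolation_pinShape, ?_⟩
  rintro ⟨φ, hφ, hher⟩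
  obtain ⟨ψ, hψ, ε, hε, hnot⟩ := modelViolation_not_hereditary φ hφ
  obtain ⟨m, -, hfreq⟩ := hher ψ hψ ε hε
  obtain ⟨k, hk₁, hk₂⟩ := ((hnot m).and_frequently hfreq).exists
  exact hk₁ hk₂

/-- By contrast the EVENTUAL shape is hereditary by pure logic (the abstract form of the landed `hereditaryPin_of_eventual`):
if every rate is violated at some tuple for ALL LARGE cutoffs, the same holds along every subsequence of every subsequence. -/
theorem eventualShape_hereditary (V : ℝ → ℝ → ℕ → Prop)
    (h : ∀ ε > (0 : ℝ), ∃ m : ℝ, 0 < m ∧ ∀ᶠ k in atTop, V ε m k) (φ : ℕ → ℕ) (hφ : StrictMono φ)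
    (ψ : ℕ → ℕ) (hψ : StrictMono ψ) :
    ∀ ε > (0 : ℝ), ∃ m : ℝ, 0 < m ∧ ∃ᶠ k in atTop, V ε m (φ (ψ k)) := fun ε hε => by
  obtain ⟨m, hm, hev⟩ := h ε hε
  exact ⟨m, hm, ((hφ.comp hψ).tendsto_atTop.eventually hev).frequently⟩

end IndependenceModel

end Summit.QuantumFields.QCD.Theorems.StronglyChiralSubsequence

end
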